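import Summits.ResolutionOfSingularities.ResolutionOfSingularities.Theorems.WildConesCampaignW46HypersurfacesCharTwoEmbDimDefs
import Summits.ResolutionOfSingularities.ResolutionOfSingularities.Theorems.WildConesCampaignW46HypersurfacesCharTwoCubicFormDefs
import Summits.ResolutionOfSingularities.ResolutionOfSingularities.Theorems.WildConesCampaignW46HypersurfacesCharTwoHilbertDefs
import Mathlib.Algebra.CharP.Defs
import Mathlib.FieldTheory.IsSepClosed
import Mathlib.Data.Matrix.Mul

/-!
# [OURS · L1 W4.6, rung (ii)] STATEMENTS on THE FIELD OF DEFINITION of the corank-two census — NULL POLARS ARE NEAR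
# (a rational infinitely-near `p`-fold point at `h₂ ≥ 2` over EVERY field; the free point IS the null polar) and
# SEPARABLY CLOSED FIELDS SUFFICE (near points for every corank `≥ 2`, EXACTLY THREE at `(2,1)`, resolved by one
# blow-up iff `μ ≤ 2`) — for hypersurface `p`-fold points `z^p = a(u₁,…,uₙ)` IN EVERY DIMENSION `n` (instance `p = 2`
# proved for all `n`) over route WildCones' point-blow-up dynamics — campaign s46 of cell res-hironaka
# (LADDER-RESOLUTION rung L, D-0089); host route WildCones, `--kind definition --supports stmt-ResolutionOfSingularities-16884`

HONEST FRAMING. Everything below is OURS (campaign statements of slot W4.6, typed by the prover res-L1-s46-pv-4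
(gen 7) in the pattern of `Theorems/WildConesCampaignW46HypersurfacesCharTwoCensusStatement.lean` (p557112, rev 5,
21 predicates; that file is past the 400-line cap, hence this new file): predicates `def … (p n : ℕ) : Prop` in the
characteristic AND THE DIMENSION, one decl per statement, no theorem, no `sorry`) over route WildCones' typed
point-blow-up dynamics (`Theorems/WildConesClassicalRegimesDefs.lean`: states `c : (Fin n → ℕ) → κ` = coefficients of
`a(u₁,…,uₙ)` in `z^p = a`, `ser` the cleaned series, `step i τ c` = blow up the point, chart `u_i`, translate by `τ`,
delete `p`-th powers; `MultP` = cleaned order `≥ p`, `Isol` = finite Milnor algebra `κ⟦u⟧/(∂a)`, `mu` = its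
dimension), the seat's invariants `CampaignW46.milnorEmbDim p n κ c = e(c)` (p498937; at `p = 2` the corank of the
POLAR MATRIX `P = ([u_s u_t] a)_{s ≠ t}`, spelled out inline as in p557112), `CampaignW46.milnorHilbertTwo p n κ c = h₂(c)`
(p511581, `dim 𝔪_A²/𝔪_A³` of the Milnor algebra) and `CampaignW46.degForm` (p522667: `degForm 3 (ser c) w = a₃(w)`, the
TANGENT CUBIC; `degForm 2 (∂ₛ ser c) v = (∂ₛa)₂(v)`). VOCABULARY: for kernel vectors `λ, v` of `P` the POLAR is
`polar(λ, v) = Σₛ λₛ (∂ₛa)₂(v)`; a NULL POLAR is a kernel `λ` with `polar(λ, ·) ≡ 0` on `ker P` (subspace `N ≤ ker P`,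
`h₂ = 1 + dim N` at `e = 2`, p542945). The near vector of a chart `i` and a translation `τ` is `w = (τ with w_i = 1)`; a
near vector is FREE when some kernel polar is non-zero at it (successor corank `0`) and a SATELLITE when all vanish
(successor corank `2`). They are NOT statements of H. Hironaka's manuscript [Hironaka2017] and use nothing from it; each
docstring says which printed item's ROLE the statement replaces (Th. 16.6 p.84: the next centre `D′ = ∇′ ∩ π⁻¹(D)` and
its field of definition), under adjudication, never as fact. No FACT-LIST premise occurs. AI bookkeeping, weaker than
expert review.

WHAT THE PACKAGE SAYS (proved at `p = 2` for every `n` in this seat's gen-7 files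
`…HypersurfacesCharTwo{NullPolarNear,SepClosed}.lean`; closers by name in `…HypersurfacesCharTwoFieldsProof.lean`).
(A) OVER EVERY FIELD: a null polar `λ` lies on the tangent cubic (`a₃(λ) = polar(λ,λ) = 0`, Euler in characteristic
`p = 2`), so `[λ]` is an infinitely-near `p`-fold point of the isolated `p`-fold point, RATIONAL over the field of
definition; hence at `(e, h₂) = (2, ≥ 2)` a near `p`-fold point EXISTS over every field (the perfect / algebraically
closed hypotheses of p538084 / p557052 were only needed for the satellite / for `h₂ = 1`). At `(2,2)`, `N = κλ₀` and
THE FREE NEAR POINT, IF ANY, IS `[λ₀]`; a free near point exists ⟺ some kernel polar is non-zero at `λ₀` (the cube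
criterion p549448 with the possibly irrational satellite replaced by the always rational null polar); the `(2,2)`
census over every field reads: `[λ₀]` and at most the satellite — at least one, at most two. (B) OVER A SEPARABLY
CLOSED FIELD: a polynomial of degree prime to the characteristic has a root, so (char. `2`) the kernel cubic along a
line has a root — every corank `≥ 2` `p`-fold point has a near `p`-fold point; next to a near point that is not a null
polar the remaining equation is `αx² + βx + γ` with `β ≠ 0`, separable — so at `(2,1)` (no null polars) the `D₄`
configuration of EXACTLY THREE free near points is rational over the separable closure; and for `n ≥ 3` an isolated
`p`-fold point is RESOLVED BY ONE point blow-up (no near `p`-fold point at all) iff `μ ≤ 2`.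

REV 2 (same seat, gen 7, APPEND-ONLY: the ten rev-1 predicates are byte-identical; three predicates appended): THE MILNOR
GAP. `CampaignW46HypersurfacesMilnorTrichotomy` (every field, every `n`: an isolated `p`-fold state has `μ = 1 ∧ e = 0`,
or `μ = 2 ∧ e = 1`, or `μ ≥ 4` — so `μ = 3` never occurs), `CampaignW46HypersurfacesMuLeTwoResolved` (every field,
`n ≥ 3`: `μ ≤ 2` ⇒ NO chart/translation has a `p`-fold successor — the field-independent half of rev 1's
`…ResolvedInOneIffMuLeTwo`), `CampaignW46HypersurfacesNearForcesMuFour` (every field, `n ≥ 3`: an isolated `p`-fold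
point WITH an infinitely-near `p`-fold point has `μ ≥ 4`). Their `p = 2` instances are PROVED for every `n` in
`…HypersurfacesCharTwoMilnorGap.lean` (p570085); closers appended to `…FieldsProof.lean`. SCOPE MARKERS of gen 7 (no
predicate): `…FourfoldRationalCubic.lean` (p568185: over `𝔽₂` a `D₄` fourfold state with `μ = 4` and NO rational near
`p`-fold point — the separable-closedness in rev 1 is needed) and `…FourfoldImperfect{Leaf,}.lean` (over `𝔽₂(X)` a
`(2,2)` fourfold state with exactly one near `p`-fold point, free, and NO satellite — the perfectness in census rev 2's
`…HilbertTwoExactCount` is needed).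

REV 3 (same seat, gen 7, APPEND-ONLY: the thirteen rev-1/rev-2 predicates are byte-identical; three predicates appended): THE
SIDEWAYS EXIT IS FORCED. `CampaignW46HypersurfacesHilbertThreeNonIsolatedExists` (every field, isolated `(2,3)`: a NON-isolated
`p`-fold successor exists — every kernel direction is one), `CampaignW46HypersurfacesSidewaysForced` (separably closed field,
isolated, `e ≥ 3` or `(e, h₂) = (2, 3)`: a `p`-fold successor exists AND every `p`-fold successor is non-isolated),
`CampaignW46ThreefoldsPointPhaseDichotomy` (separably closed field, `n = 3`, isolated: EITHER order-2 cleaned with every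
`p`-fold successor order-2 cleaned, isolated, `μ' + 2 = μ`, OR cleaned order `3` with a `p`-fold successor and all of them
non-isolated). Their `p = 2` instances are PROVED in `…HypersurfacesCharTwoSidewaysForced.lean` (p572265); closers appended to
`…FieldsProof.lean`.

## References

* [GreuelPfister2026] G.-M. Greuel, G. Pfister, The splitting lemma in any characteristic, J. Algebra 689 (2026)
  = arXiv:2507.17078, Thm 3.5 and Cor 3.7 (hyperbolic pairs in characteristic two: context of `e`, `P`).
* [CasasAlvero2000] E. Casas-Alvero, Singularities of Plane Curves, LMS LN 276 (2000), §3 (free and satellite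
  infinitely near points of plane curves: context for the names only).
* [Hironaka2017] H. Hironaka, ms. 2017-03-23, Th. 16.6 p.84, §16.3 / Th. 16.13 p.87 — ROLE replaced only.
-/

noncomputable section

set_option linter.dupNamespace false -- mandated namespace of this single-conjunct summit

open scoped Classical

namespace Summit.ResolutionOfSingularities.ResolutionOfSingularities.Theorems

/-- [OURS · L1 W4.6 rung (ii), every dimension, EVERY field; fields rev 1] replaces the role of the FIELD OF DEFINITION
of the next centre `D′` (Th. 16.6 p.84 L5–L6) at a null polar: NOT a statement of the manuscript. For every field `κ`
of characteristic `p`, every ISOLATED `p`-fold state `c` of `z^p = a(u₁,…,uₙ)` (any corank) and every NON-ZERO kernel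
vector `λ` of the polar matrix whose polar `v ↦ Σₛ λₛ (∂ₛa)₂(v)` vanishes at every kernel vector (a non-zero NULL
POLAR): some chart `i` and translation `τ` give a `p`-fold successor whose near vector `(τ with τ_i = 1)` is a multiple
of `λ` — `[λ]` IS an infinitely-near `p`-fold point, rational over `κ`. Instance `p = 2` PROVED for every `n` by
`CampaignW46.HypersurfacesCharTwo.hypersurface_exists_double_successor_of_null_polar` (the NullPolarNear file: Euler
`a₃(λ) = polar(λ,λ) = 0` and the near-point criterion p524988); other `p` not claimed. [folklore] -/
def CampaignW46HypersurfacesNullPolarNear (p n : ℕ) : Prop :=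
  ∀ (κ : Type) [Field κ] [CharP κ p] (c : (Fin n → ℕ) → κ) (lam : Fin n → κ),
    WildCones.MultP p n κ c → WildCones.Isol p n κ c → lam ≠ 0 →
      Matrix.vecMul lam (Matrix.of fun s t : Fin n => if s = t then (0 : κ)
        else MvPowerSeries.coeff (Finsupp.single s 1 + Finsupp.single t 1) (WildCones.ser p n κ c)) = 0 →
        (∀ v : Fin n → κ,
          Matrix.vecMul v (Matrix.of fun s t : Fin n => if s = t then (0 : κ)
            else MvPowerSeries.coeff (Finsupp.single s 1 + Finsupp.single t 1) (WildCones.ser p n κ c)) = 0 →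
            ∑ s, lam s * CampaignW46.degForm 2
              (Literature.AlgebraicGeometry.Resolution.MvPowerSeries.pderiv s (WildCones.ser p n κ c)) v = 0) →
          ∃ (i : Fin n) (τ : Fin n → κ), WildCones.MultP p n κ (WildCones.step p n κ i τ c) ∧
            ∃ r : κ, Function.update τ i 1 = r • lam

/-- [OURS · L1 W4.6 rung (ii), every dimension, EVERY field; fields rev 1] replaces the role of the EXISTENCE of the
next centre `D′` (Th. 16.6 p.84 L5–L6) over the field of definition in the classes `(e, h₂) = (2, 2), (2, 3)`; NOT a
statement of the manuscript. For every field `κ` of characteristic `p` and every isolated `p`-fold state `c` of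
`z^p = a(u₁,…,uₙ)` with `e(c) = 2` and `h₂(c) ≥ 2`: some chart and translation give a `p`-fold successor — an
infinitely-near `p`-fold point EXISTS, with no hypothesis on `κ` (at `h₂ = 1` this fails over `𝔽₂`). Instance `p = 2`
PROVED for every `n` by `CampaignW46.HypersurfacesCharTwo.hypersurface_exists_double_successor_of_two_le_milnorHilbertTwo`
(the NullPolarNear file, with p538084's null polar at `h₂ ≥ 2`); other `p` not claimed. [folklore] -/
def CampaignW46HypersurfacesHilbertTwoNearExists (p n : ℕ) : Prop :=
  ∀ (κ : Type) [Field κ] [CharP κ p] (c : (Fin n → ℕ) → κ),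
    WildCones.MultP p n κ c → WildCones.Isol p n κ c → CampaignW46.milnorEmbDim p n κ c = 2 →
      2 ≤ CampaignW46.milnorHilbertTwo p n κ c →
        ∃ (i : Fin n) (τ : Fin n → κ), WildCones.MultP p n κ (WildCones.step p n κ i τ c)

/-- [OURS · L1 W4.6 rung (ii), every dimension, EVERY field; fields rev 1] replaces the role of the DESCRIPTION of the
next centres (Th. 16.6 p.84 L5–L6) — WHERE the free near point is; NOT a statement of the manuscript. For every field
`κ` of characteristic `p`, every `p`-fold state `c` of `z^p = a(u₁,…,uₙ)` with `e(c) = 2`, every non-zero null polar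
`λ₀`, and every chart/translation `(i, τ)` whose successor is a `p`-fold point of corank `0` (a FREE near point): the
near vector `(τ with τ_i = 1)` is a multiple of `λ₀` — THE FREE NEAR POINT IS THE NULL POLAR. Instance `p = 2` PROVED
for every `n` by `CampaignW46.HypersurfacesCharTwo.hypersurface_free_successor_at_null_polar` (the NullPolarNear file:
with `K = ⟨λ₀, w⟩` every kernel polar at a free `w ∉ κλ₀` would be `α·0 + β·a₃(w) = 0`); other `p` not claimed.
[folklore] -/
def CampaignW46HypersurfacesFreePointIsNullPolar (p n : ℕ) : Prop :=
  ∀ (κ : Type) [Field κ] [CharP κ p] (c : (Fin n → ℕ) → κ) (lam₀ : Fin n → κ) (i : Fin n) (τ : Fin n → κ),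
    WildCones.MultP p n κ c → CampaignW46.milnorEmbDim p n κ c = 2 → lam₀ ≠ 0 →
      Matrix.vecMul lam₀ (Matrix.of fun s t : Fin n => if s = t then (0 : κ)
        else MvPowerSeries.coeff (Finsupp.single s 1 + Finsupp.single t 1) (WildCones.ser p n κ c)) = 0 →
        (∀ v : Fin n → κ,
          Matrix.vecMul v (Matrix.of fun s t : Fin n => if s = t then (0 : κ)
            else MvPowerSeries.coeff (Finsupp.single s 1 + Finsupp.single t 1) (WildCones.ser p n κ c)) = 0 →
            ∑ s, lam₀ s * CampaignW46.degForm 2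
              (Literature.AlgebraicGeometry.Resolution.MvPowerSeries.pderiv s (WildCones.ser p n κ c)) v = 0) →
          WildCones.MultP p n κ (WildCones.step p n κ i τ c) →
            CampaignW46.milnorEmbDim p n κ (WildCones.step p n κ i τ c) = 0 →
              ∃ r : κ, Function.update τ i 1 = r • lam₀

/-- [OURS · L1 W4.6 rung (ii), every dimension, EVERY field; fields rev 1] replaces the role of the DESCRIPTION of the
next centres (Th. 16.6 p.84 L5–L6) — whether a free one exists — for the multiple-tangent class over the field of
definition; NOT a statement of the manuscript. For every field `κ` of characteristic `p`, every isolated `p`-fold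
state `c` of `z^p = a(u₁,…,uₙ)` with `e(c) = 2` and every non-zero null polar `λ₀`: a `p`-fold successor of corank
`0` (a FREE infinitely-near `p`-fold point) EXISTS if and only if some kernel polar is non-zero at `λ₀` — THE CUBE
CRITERION of census rev 2 with the satellite (possibly irrational over an imperfect field) replaced by the always
rational null polar. Instance `p = 2` PROVED for every `n` by
`CampaignW46.HypersurfacesCharTwo.hypersurface_exists_free_iff_null_polar_not_satellite` (the NullPolarNear file);
other `p` not claimed. [folklore] -/
def CampaignW46HypersurfacesNullPolarCubeCriterion (p n : ℕ) : Prop :=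
  ∀ (κ : Type) [Field κ] [CharP κ p] (c : (Fin n → ℕ) → κ) (lam₀ : Fin n → κ),
    WildCones.MultP p n κ c → WildCones.Isol p n κ c → CampaignW46.milnorEmbDim p n κ c = 2 → lam₀ ≠ 0 →
      Matrix.vecMul lam₀ (Matrix.of fun s t : Fin n => if s = t then (0 : κ)
        else MvPowerSeries.coeff (Finsupp.single s 1 + Finsupp.single t 1) (WildCones.ser p n κ c)) = 0 →
        (∀ v : Fin n → κ,
          Matrix.vecMul v (Matrix.of fun s t : Fin n => if s = t then (0 : κ)
            else MvPowerSeries.coeff (Finsupp.single s 1 + Finsupp.single t 1) (WildCones.ser p n κ c)) = 0 →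
            ∑ s, lam₀ s * CampaignW46.degForm 2
              (Literature.AlgebraicGeometry.Resolution.MvPowerSeries.pderiv s (WildCones.ser p n κ c)) v = 0) →
          ((∃ (i : Fin n) (τ : Fin n → κ), WildCones.MultP p n κ (WildCones.step p n κ i τ c) ∧
              CampaignW46.milnorEmbDim p n κ (WildCones.step p n κ i τ c) = 0) ↔
            ∃ μ : Fin n → κ,
              Matrix.vecMul μ (Matrix.of fun s t : Fin n => if s = t then (0 : κ)
                else MvPowerSeries.coeff (Finsupp.single s 1 + Finsupp.single t 1) (WildCones.ser p n κ c)) = 0 ∧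
                ∑ s, μ s * CampaignW46.degForm 2
                  (Literature.AlgebraicGeometry.Resolution.MvPowerSeries.pderiv s (WildCones.ser p n κ c)) lam₀ ≠ 0)

/-- [OURS · L1 W4.6 rung (ii), every dimension, EVERY field; fields rev 1] replaces the role of the DESCRIPTION of the
next centres (Th. 16.6 p.84 L5–L6) for the multiple-tangent class over the field of definition — THE DICHOTOMY AT THE
NULL POLAR; NOT a statement of the manuscript. For every field `κ` of characteristic `p`, every isolated `p`-fold state
`c` of `z^p = a(u₁,…,uₙ)` with `(e, h₂) = (2, 2)` and every non-zero null polar `λ₀`: EITHER (a) some kernel polar is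
non-zero at `λ₀`, some chart/translation with near vector in `κλ₀` has a `p`-fold successor of corank `0` — isolated,
`μ = 1`, no `p`-fold point after it — and every `p`-fold successor whose near vector is NOT in `κλ₀` has corank `2`, is
isolated and has smaller `μ` (a satellite); OR (b) all kernel polars vanish at `λ₀` and EVERY `p`-fold successor has
near vector in `κλ₀` and corank `2` (the cube case: exactly one infinitely-near `p`-fold point). Instance `p = 2`
PROVED for every `n` by `CampaignW46.HypersurfacesCharTwo.hypersurface_null_polar_dichotomy` (the NullPolarNear file);
other `p` not claimed. [folklore] -/
def CampaignW46HypersurfacesNullPolarDichotomy (p n : ℕ) : Prop :=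
  ∀ (κ : Type) [Field κ] [CharP κ p] (c : (Fin n → ℕ) → κ) (lam₀ : Fin n → κ),
    WildCones.MultP p n κ c → WildCones.Isol p n κ c → CampaignW46.milnorEmbDim p n κ c = 2 →
      CampaignW46.milnorHilbertTwo p n κ c = 2 → lam₀ ≠ 0 →
      Matrix.vecMul lam₀ (Matrix.of fun s t : Fin n => if s = t then (0 : κ)
        else MvPowerSeries.coeff (Finsupp.single s 1 + Finsupp.single t 1) (WildCones.ser p n κ c)) = 0 →
        (∀ v : Fin n → κ,
          Matrix.vecMul v (Matrix.of fun s t : Fin n => if s = t then (0 : κ)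
            else MvPowerSeries.coeff (Finsupp.single s 1 + Finsupp.single t 1) (WildCones.ser p n κ c)) = 0 →
            ∑ s, lam₀ s * CampaignW46.degForm 2
              (Literature.AlgebraicGeometry.Resolution.MvPowerSeries.pderiv s (WildCones.ser p n κ c)) v = 0) →
          ((∃ μ : Fin n → κ,
              Matrix.vecMul μ (Matrix.of fun s t : Fin n => if s = t then (0 : κ)
                else MvPowerSeries.coeff (Finsupp.single s 1 + Finsupp.single t 1) (WildCones.ser p n κ c)) = 0 ∧
                ∑ s, μ s * CampaignW46.degForm 2
                  (Literature.AlgebraicGeometry.Resolution.MvPowerSeries.pderiv s (WildCones.ser p n κ c)) lam₀ ≠ 0) ∧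
              (∃ (i : Fin n) (τ : Fin n → κ), WildCones.MultP p n κ (WildCones.step p n κ i τ c) ∧
                CampaignW46.milnorEmbDim p n κ (WildCones.step p n κ i τ c) = 0 ∧
                WildCones.Isol p n κ (WildCones.step p n κ i τ c) ∧
                WildCones.mu p n κ (WildCones.step p n κ i τ c) = 1 ∧
                (∀ (i' : Fin n) (τ' : Fin n → κ),
                  ¬ WildCones.MultP p n κ (WildCones.step p n κ i' τ' (WildCones.step p n κ i τ c))) ∧
                ∃ r : κ, Function.update τ i 1 = r • lam₀) ∧
              ∀ (i : Fin n) (τ : Fin n → κ), WildCones.MultP p n κ (WildCones.step p n κ i τ c) →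
                (∀ r : κ, Function.update τ i 1 ≠ r • lam₀) →
                  CampaignW46.milnorEmbDim p n κ (WildCones.step p n κ i τ c) = 2 ∧
                    WildCones.Isol p n κ (WildCones.step p n κ i τ c) ∧
                    WildCones.mu p n κ (WildCones.step p n κ i τ c) < WildCones.mu p n κ c) ∨
            ((∀ μ : Fin n → κ,
                Matrix.vecMul μ (Matrix.of fun s t : Fin n => if s = t then (0 : κ)
                  else MvPowerSeries.coeff (Finsupp.single s 1 + Finsupp.single t 1) (WildCones.ser p n κ c)) = 0 →
                  ∑ s, μ s * CampaignW46.degForm 2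
                    (Literature.AlgebraicGeometry.Resolution.MvPowerSeries.pderiv s (WildCones.ser p n κ c)) lam₀ = 0) ∧
              ∀ (i : Fin n) (τ : Fin n → κ), WildCones.MultP p n κ (WildCones.step p n κ i τ c) →
                (∃ r : κ, Function.update τ i 1 = r • lam₀) ∧
                  CampaignW46.milnorEmbDim p n κ (WildCones.step p n κ i τ c) = 2)

/-- [OURS · L1 W4.6 rung (ii), every dimension, EVERY field; fields rev 1] replaces the role of the DESCRIPTION of the
next centres (Th. 16.6 p.84 L5–L6) for the multiple-tangent class `(e, h₂) = (2, 2)` OVER THE FIELD OF DEFINITION (no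
perfectness); NOT a statement of the manuscript. For every field `κ` of characteristic `p` and every isolated `p`-fold
state `c` of `z^p = a(u₁,…,uₙ)` with `e(c) = 2`, `h₂(c) = 2`: there is a non-zero null polar `λ₀` such that (1) some
chart/translation with near vector in `κλ₀` has a `p`-fold successor (`[λ₀]` IS an infinitely-near `p`-fold point),
and (2) every `p`-fold successor is EITHER of corank `0`, isolated, `μ = 1`, with no `p`-fold point after it AND near
vector in `κλ₀` (free, at `[λ₀]`), OR of corank `2`, isolated, with smaller `μ`, all kernel polars vanishing at its
near vector (a satellite; at most one, census rev 1). So over every field the infinitely-near `p`-fold points are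
`[λ₀]` and at most the satellite: AT LEAST ONE, at most two. Instance `p = 2` PROVED for every `n` by
`CampaignW46.HypersurfacesCharTwo.hypersurface_near_census_anyField_of_milnorHilbertTwo_eq_two` (the NullPolarNear
file); other `p` not claimed. [folklore] -/
def CampaignW46HypersurfacesHilbertTwoCensusAnyField (p n : ℕ) : Prop :=
  ∀ (κ : Type) [Field κ] [CharP κ p] (c : (Fin n → ℕ) → κ),
    WildCones.MultP p n κ c → WildCones.Isol p n κ c → CampaignW46.milnorEmbDim p n κ c = 2 →
      CampaignW46.milnorHilbertTwo p n κ c = 2 →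
        ∃ lam₀ : Fin n → κ, lam₀ ≠ 0 ∧
          Matrix.vecMul lam₀ (Matrix.of fun s t : Fin n => if s = t then (0 : κ)
            else MvPowerSeries.coeff (Finsupp.single s 1 + Finsupp.single t 1) (WildCones.ser p n κ c)) = 0 ∧
          (∀ v : Fin n → κ,
            Matrix.vecMul v (Matrix.of fun s t : Fin n => if s = t then (0 : κ)
              else MvPowerSeries.coeff (Finsupp.single s 1 + Finsupp.single t 1) (WildCones.ser p n κ c)) = 0 →
              ∑ s, lam₀ s * CampaignW46.degForm 2
                (Literature.AlgebraicGeometry.Resolution.MvPowerSeries.pderiv s (WildCones.ser p n κ c)) v = 0) ∧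
          (∃ (i : Fin n) (τ : Fin n → κ), WildCones.MultP p n κ (WildCones.step p n κ i τ c) ∧
            ∃ r : κ, Function.update τ i 1 = r • lam₀) ∧
          ∀ (i : Fin n) (τ : Fin n → κ), WildCones.MultP p n κ (WildCones.step p n κ i τ c) →
            (CampaignW46.milnorEmbDim p n κ (WildCones.step p n κ i τ c) = 0 ∧
                WildCones.Isol p n κ (WildCones.step p n κ i τ c) ∧
                WildCones.mu p n κ (WildCones.step p n κ i τ c) = 1 ∧
                (∀ (i' : Fin n) (τ' : Fin n → κ),
                  ¬ WildCones.MultP p n κ (WildCones.step p n κ i' τ' (WildCones.step p n κ i τ c))) ∧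
                ∃ r : κ, Function.update τ i 1 = r • lam₀) ∨
              (CampaignW46.milnorEmbDim p n κ (WildCones.step p n κ i τ c) = 2 ∧
                WildCones.Isol p n κ (WildCones.step p n κ i τ c) ∧
                WildCones.mu p n κ (WildCones.step p n κ i τ c) < WildCones.mu p n κ c ∧
                ∀ μ : Fin n → κ,
                  Matrix.vecMul μ (Matrix.of fun s t : Fin n => if s = t then (0 : κ)
                    else MvPowerSeries.coeff (Finsupp.single s 1 + Finsupp.single t 1) (WildCones.ser p n κ c)) = 0 →
                    ∑ s, μ s * CampaignW46.degForm 2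
                      (Literature.AlgebraicGeometry.Resolution.MvPowerSeries.pderiv s (WildCones.ser p n κ c))
                      (Function.update τ i 1) = 0)

/-- [OURS · L1 W4.6 rung (ii), every dimension, SEPARABLY CLOSED field; fields rev 1] replaces the role of the
EXISTENCE of the next centre `D′` (Th. 16.6 p.84 L5–L6) for corank `≥ 2` over a separably closed field; NOT a
statement of the manuscript. For every separably closed field `κ` of characteristic `p` and every isolated `p`-fold
state `c` of `z^p = a(u₁,…,uₙ)` with `e(c) ≥ 2`: some chart and translation give a `p`-fold successor (for `e ≥ 3` or
`(e, h₂) = (2, 3)` a non-isolated one). Instance `p = 2` PROVED for every `n` by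
`CampaignW46.HypersurfacesCharTwo.hypersurface_exists_double_successor_of_isSepClosed` (the SepClosed file: over a
separably closed field of characteristic `2` a genuine cubic has a root — odd degree); other `p` not claimed.
[folklore] -/
def CampaignW46HypersurfacesSepClosedNearExists (p n : ℕ) : Prop :=
  ∀ (κ : Type) [Field κ] [CharP κ p] [IsSepClosed κ] (c : (Fin n → ℕ) → κ),
    WildCones.MultP p n κ c → WildCones.Isol p n κ c → 2 ≤ CampaignW46.milnorEmbDim p n κ c →
      ∃ (i : Fin n) (τ : Fin n → κ), WildCones.MultP p n κ (WildCones.step p n κ i τ c)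

/-- [OURS · L1 W4.6 rung (ii), every dimension, SEPARABLY CLOSED field; fields rev 1] replaces the role of NOTHING
printed (a structural fact of OUR kernel cubic over a separably closed field); NOT a statement of the manuscript. For
every separably closed field `κ` of characteristic `p`, every `p`-fold state `c` of `z^p = a(u₁,…,uₙ)` with `e(c) = 2`
and every non-zero kernel vector `w₁` on the tangent cubic whose polar does NOT vanish on the kernel (not a null
polar): some kernel vector on the tangent cubic is NOT a multiple of `w₁` — next to a non-null near point there is a
second near point (the residual equation `αx² + βx + γ` has `β = polar(w₁, v) ≠ 0`: separable). Instance `p = 2`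
PROVED for every `n` by `CampaignW46.HypersurfacesCharTwo.hypersurface_exists_second_near_of_not_null_of_isSepClosed`
(the SepClosed file); other `p` not claimed. [folklore] -/
def CampaignW46HypersurfacesSepClosedSecondNear (p n : ℕ) : Prop :=
  ∀ (κ : Type) [Field κ] [CharP κ p] [IsSepClosed κ] (c : (Fin n → ℕ) → κ) (w₁ : Fin n → κ),
    WildCones.MultP p n κ c → CampaignW46.milnorEmbDim p n κ c = 2 → w₁ ≠ 0 →
      Matrix.vecMul w₁ (Matrix.of fun s t : Fin n => if s = t then (0 : κ)
        else MvPowerSeries.coeff (Finsupp.single s 1 + Finsupp.single t 1) (WildCones.ser p n κ c)) = 0 →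
        CampaignW46.degForm 3 (WildCones.ser p n κ c) w₁ = 0 →
          (∃ u : Fin n → κ,
            Matrix.vecMul u (Matrix.of fun s t : Fin n => if s = t then (0 : κ)
              else MvPowerSeries.coeff (Finsupp.single s 1 + Finsupp.single t 1) (WildCones.ser p n κ c)) = 0 ∧
              ∑ s, w₁ s * CampaignW46.degForm 2
                (Literature.AlgebraicGeometry.Resolution.MvPowerSeries.pderiv s (WildCones.ser p n κ c)) u ≠ 0) →
            ∃ w₂ : Fin n → κ,
              Matrix.vecMul w₂ (Matrix.of fun s t : Fin n => if s = t then (0 : κ)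
                else MvPowerSeries.coeff (Finsupp.single s 1 + Finsupp.single t 1) (WildCones.ser p n κ c)) = 0 ∧
                CampaignW46.degForm 3 (WildCones.ser p n κ c) w₂ = 0 ∧ ∀ r : κ, w₂ ≠ r • w₁

/-- [OURS · L1 W4.6 rung (ii), every dimension, SEPARABLY CLOSED field; fields rev 1] replaces the role of the
DESCRIPTION of the next centres (Th. 16.6 p.84 L5–L6) for the three-tangents class of isolated corank-two hypersurface
`p`-fold points over a SEPARABLY closed field, EXACTLY; NOT a statement of the manuscript. For every separably closed
field `κ` of characteristic `p` and every isolated `p`-fold state `c` of `z^p = a(u₁,…,uₙ)` with `e(c) = 2`,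
`h₂(c) = 1`: there are three charts/translations `(i₁,τ₁)`, `(i₂,τ₂)`, `(i₃,τ₃)` whose successors are `p`-fold points
of corank `0` and whose near vectors are pairwise non-proportional (with census rev 1's bound `≤ 3`: exactly three
infinitely-near `p`-fold points, all free — the `D₄` configuration is étale-local; census rev 5 needed `κ`
algebraically closed). Instance `p = 2` PROVED for every `n` by
`CampaignW46.HypersurfacesCharTwo.hypersurface_three_near_points_of_isSepClosed` (the SepClosed file); other `p` not
claimed. [cite: CasasAlvero2000, §3] -/
def CampaignW46HypersurfacesThreeTangentsSepClosed (p n : ℕ) : Prop :=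
  ∀ (κ : Type) [Field κ] [CharP κ p] [IsSepClosed κ] (c : (Fin n → ℕ) → κ),
    WildCones.MultP p n κ c → WildCones.Isol p n κ c → CampaignW46.milnorEmbDim p n κ c = 2 →
      CampaignW46.milnorHilbertTwo p n κ c = 1 →
        ∃ (i₁ i₂ i₃ : Fin n) (τ₁ τ₂ τ₃ : Fin n → κ),
          (WildCones.MultP p n κ (WildCones.step p n κ i₁ τ₁ c) ∧ CampaignW46.milnorEmbDim p n κ (WildCones.step p n κ i₁ τ₁ c) = 0) ∧
          (WildCones.MultP p n κ (WildCones.step p n κ i₂ τ₂ c) ∧ CampaignW46.milnorEmbDim p n κ (WildCones.step p n κ i₂ τ₂ c) = 0) ∧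
          (WildCones.MultP p n κ (WildCones.step p n κ i₃ τ₃ c) ∧ CampaignW46.milnorEmbDim p n κ (WildCones.step p n κ i₃ τ₃ c) = 0) ∧
          (∀ r : κ, Function.update τ₂ i₂ 1 ≠ r • Function.update τ₁ i₁ 1) ∧
          (∀ r : κ, Function.update τ₃ i₃ 1 ≠ r • Function.update τ₁ i₁ 1) ∧
          (∀ r : κ, Function.update τ₃ i₃ 1 ≠ r • Function.update τ₂ i₂ 1)

/-- [OURS · L1 W4.6 rung (ii), every dimension `n ≥ 3`, SEPARABLY CLOSED field; fields rev 1] replaces the role of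
the TERMINATION IN ONE STEP of the chain of centres of Main Theorem I / Th. 16.6 p.84 at an isolated hypersurface
`p`-fold point, read off the Milnor number; NOT a statement of the manuscript. For every separably closed field `κ` of
characteristic `p`, every `n ≥ 3` and every isolated `p`-fold state `c` of `z^p = a(u₁,…,uₙ)`: NO chart and translation
gives a `p`-fold successor (the point blow-up resolves the `p`-fold point at once) IF AND ONLY IF `μ(c) ≤ 2` (`e = 0`:
`μ = 1`, never a successor; `e = 1`: none iff `μ = 2`, p505045; `e ≥ 2`: `μ ≥ 3` and a near point exists over `κ`).
Instance `p = 2` PROVED for every `n ≥ 3` by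
`CampaignW46.HypersurfacesCharTwo.hypersurface_resolved_in_one_iff_mu_le_two_of_isSepClosed` (the SepClosed file);
other `p` not claimed. [folklore] -/
def CampaignW46HypersurfacesResolvedInOneIffMuLeTwo (p n : ℕ) : Prop :=
  ∀ (κ : Type) [Field κ] [CharP κ p] [IsSepClosed κ] (c : (Fin n → ℕ) → κ), 3 ≤ n →
    WildCones.MultP p n κ c → WildCones.Isol p n κ c →
      ((∀ (i : Fin n) (τ : Fin n → κ), ¬ WildCones.MultP p n κ (WildCones.step p n κ i τ c)) ↔
        WildCones.mu p n κ c ≤ 2)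

/-- [OURS · L1 W4.6 rung (ii), every dimension, EVERY field; fields rev 2] replaces the role of NOTHING printed (a
structural fact of OUR invariants `μ`, `e`: the Milnor gap); NOT a statement of the manuscript. For every field `κ` of
characteristic `p` and every ISOLATED `p`-fold state `c` of `z^p = a(u₁,…,uₙ)`: EITHER `μ(c) = 1` and `e(c) = 0`, OR
`μ(c) = 2` and `e(c) = 1`, OR `μ(c) ≥ 4` — in particular `μ = 3` never occurs. Instance `p = 2` PROVED for every `n`
by `CampaignW46.HypersurfacesCharTwo.hypersurface_mu_trichotomy` (the MilnorGap file: `e = 0 ⟺ μ = 1`, gen 3;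
`e = 1 ⟹ μ` even `≥ 2`, p501431; `e ≥ 2 ⟹ μ ≥ h₂ + e + 1 ≥ 4`, p517132); other `p` not claimed. [folklore] -/
def CampaignW46HypersurfacesMilnorTrichotomy (p n : ℕ) : Prop :=
  ∀ (κ : Type) [Field κ] [CharP κ p] (c : (Fin n → ℕ) → κ),
    WildCones.MultP p n κ c → WildCones.Isol p n κ c →
      (WildCones.mu p n κ c = 1 ∧ CampaignW46.milnorEmbDim p n κ c = 0) ∨
        (WildCones.mu p n κ c = 2 ∧ CampaignW46.milnorEmbDim p n κ c = 1) ∨ 4 ≤ WildCones.mu p n κ c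

/-- [OURS · L1 W4.6 rung (ii), every dimension `n ≥ 3`, EVERY field; fields rev 2] replaces the role of the TERMINATION
IN ONE STEP of the chain of centres of Main Theorem I / Th. 16.6 p.84 at an isolated hypersurface `p`-fold point with
`μ ≤ 2`, over the field of definition; NOT a statement of the manuscript. For every field `κ` of characteristic `p`,
every `n ≥ 3` and every isolated `p`-fold state `c` of `z^p = a(u₁,…,uₙ)` with `μ(c) ≤ 2`: NO chart and translation
gives a `p`-fold successor (the point blow-up resolves the `p`-fold point at once). This is the field-independent half
of rev 1's `CampaignW46HypersurfacesResolvedInOneIffMuLeTwo`; its converse needs a separably closed field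
(`…FourfoldRationalCubic`, p568185). Instance `p = 2` PROVED for every `n ≥ 3` by
`CampaignW46.HypersurfacesCharTwo.hypersurface_resolved_in_one_of_mu_le_two` (the MilnorGap file); other `p` not
claimed. [folklore] -/
def CampaignW46HypersurfacesMuLeTwoResolved (p n : ℕ) : Prop :=
  ∀ (κ : Type) [Field κ] [CharP κ p] (c : (Fin n → ℕ) → κ) (i : Fin n) (τ : Fin n → κ), 3 ≤ n →
    WildCones.MultP p n κ c → WildCones.Isol p n κ c → WildCones.mu p n κ c ≤ 2 →
      ¬ WildCones.MultP p n κ (WildCones.step p n κ i τ c)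

/-- [OURS · L1 W4.6 rung (ii), every dimension `n ≥ 3`, EVERY field; fields rev 2] replaces the role of NOTHING printed
(a structural fact of OUR invariant `μ` along the chain of centres of Th. 16.6 p.84); NOT a statement of the
manuscript. For every field `κ` of characteristic `p`, every `n ≥ 3` and every isolated `p`-fold state `c` of
`z^p = a(u₁,…,uₙ)`: if some chart and translation gives a `p`-fold successor (an infinitely-near `p`-fold point
exists), then `μ(c) ≥ 4`. Instance `p = 2` PROVED for every `n ≥ 3` by
`CampaignW46.HypersurfacesCharTwo.hypersurface_four_le_mu_of_exists_double_successor` (the MilnorGap file); other `p`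
not claimed. [folklore] -/
def CampaignW46HypersurfacesNearForcesMuFour (p n : ℕ) : Prop :=
  ∀ (κ : Type) [Field κ] [CharP κ p] (c : (Fin n → ℕ) → κ), 3 ≤ n →
    WildCones.MultP p n κ c → WildCones.Isol p n κ c →
      (∃ (i : Fin n) (τ : Fin n → κ), WildCones.MultP p n κ (WildCones.step p n κ i τ c)) → 4 ≤ WildCones.mu p n κ c

/-- [OURS · L1 W4.6 rung (ii), every dimension, EVERY field; fields rev 3] replaces the role of the EXISTENCE of the
next centre `D′` (Th. 16.6 p.84 L5–L6) in the no-tangent-cubic class `(e, h₂) = (2, 3)`, with its type; NOT a statement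
of the manuscript. For every field `κ` of characteristic `p` and every isolated `p`-fold state `c` of
`z^p = a(u₁,…,uₙ)` with `e(c) = 2`, `h₂(c) = 3`: some chart and translation give a `p`-fold successor which is NOT
isolated. Instance `p = 2` PROVED for every `n` by
`CampaignW46.HypersurfacesCharTwo.hypersurface_exists_nonisolated_successor_of_milnorHilbertTwo_eq_three` (the
SidewaysForced file, from p530584: every kernel direction is near and non-isolated); other `p` not claimed. [folklore] -/
def CampaignW46HypersurfacesHilbertThreeNonIsolatedExists (p n : ℕ) : Prop :=
  ∀ (κ : Type) [Field κ] [CharP κ p] (c : (Fin n → ℕ) → κ),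
    WildCones.MultP p n κ c → WildCones.Isol p n κ c → CampaignW46.milnorEmbDim p n κ c = 2 →
      CampaignW46.milnorHilbertTwo p n κ c = 3 →
        ∃ (i : Fin n) (τ : Fin n → κ), WildCones.MultP p n κ (WildCones.step p n κ i τ c) ∧
          ¬ WildCones.Isol p n κ (WildCones.step p n κ i τ c)

/-- [OURS · L1 W4.6 rung (ii), every dimension, SEPARABLY CLOSED field; fields rev 3] replaces the role of the passage
from point centres to higher-dimensional centres in the chain of Main Theorem I / Th. 16.6 p.84 (the point phase CANNOT
finish and CANNOT continue at isolated `p`-fold points); NOT a statement of the manuscript. For every separably closed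
field `κ` of characteristic `p` and every isolated `p`-fold state `c` of `z^p = a(u₁,…,uₙ)` with `e(c) ≥ 3` or
(`e(c) = 2` and `h₂(c) = 3`): some chart and translation give a `p`-fold successor, AND every `p`-fold successor (any
chart, any translation) is NOT isolated — the sideways exit is forced. Instance `p = 2` PROVED for every `n` by
`CampaignW46.HypersurfacesCharTwo.hypersurface_sideways_forced_of_isSepClosed` (the SidewaysForced file: rev 1's
`…SepClosedNearExists` with p501990 / p513980); other `p` not claimed. [folklore] -/
def CampaignW46HypersurfacesSidewaysForced (p n : ℕ) : Prop :=
  ∀ (κ : Type) [Field κ] [CharP κ p] [IsSepClosed κ] (c : (Fin n → ℕ) → κ),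
    WildCones.MultP p n κ c → WildCones.Isol p n κ c →
      (3 ≤ CampaignW46.milnorEmbDim p n κ c ∨
        (CampaignW46.milnorEmbDim p n κ c = 2 ∧ CampaignW46.milnorHilbertTwo p n κ c = 3)) →
        (∃ (i : Fin n) (τ : Fin n → κ), WildCones.MultP p n κ (WildCones.step p n κ i τ c) ∧
            ¬ WildCones.Isol p n κ (WildCones.step p n κ i τ c)) ∧
          ∀ (i : Fin n) (τ : Fin n → κ), WildCones.MultP p n κ (WildCones.step p n κ i τ c) →
            ¬ WildCones.Isol p n κ (WildCones.step p n κ i τ c)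

/-- [OURS · L1 W4.6 rung (ii), THREEFOLDS (`n = 3`), SEPARABLY CLOSED field; fields rev 3] replaces the role of the
point phase of the chain of centres of Main Theorem I / Th. 16.6 p.84 for an isolated threefold hypersurface `p`-fold
point over a separably closed field — the DICHOTOMY; NOT a statement of the manuscript. For every separably closed field
`κ` of characteristic `p` and every isolated `p`-fold state `c` of `z^p = a(u₀,u₁,u₂)`: EITHER `c` is order-`p` cleaned
(`OrdP`) and every `p`-fold successor is order-`p` cleaned, isolated, with `μ' + 2 = μ` (the deterministic hyperbolic
chain), OR `c` is not order-`p` cleaned, some chart/translation gives a `p`-fold successor, and EVERY `p`-fold successor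
is NOT isolated (forced sideways exit to one-dimensional centres). Instance `p = 2` PROVED by
`CampaignW46.HypersurfacesCharTwo.threefold_point_phase_dichotomy_of_isSepClosed` (the SidewaysForced file, with
p479260's `threefold_regime_step`); other `p` not claimed. [folklore] -/
def CampaignW46ThreefoldsPointPhaseDichotomy (p : ℕ) : Prop :=
  ∀ (κ : Type) [Field κ] [CharP κ p] [IsSepClosed κ] (c : (Fin 3 → ℕ) → κ),
    WildCones.MultP p 3 κ c → WildCones.Isol p 3 κ c →
      (WildCones.OrdP p 3 κ c ∧ ∀ (i : Fin 3) (τ : Fin 3 → κ), WildCones.MultP p 3 κ (WildCones.step p 3 κ i τ c) →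
          WildCones.OrdP p 3 κ (WildCones.step p 3 κ i τ c) ∧ WildCones.Isol p 3 κ (WildCones.step p 3 κ i τ c) ∧
            WildCones.mu p 3 κ (WildCones.step p 3 κ i τ c) + 2 = WildCones.mu p 3 κ c) ∨
        (¬ WildCones.OrdP p 3 κ c ∧
          (∃ (i : Fin 3) (τ : Fin 3 → κ), WildCones.MultP p 3 κ (WildCones.step p 3 κ i τ c) ∧
            ¬ WildCones.Isol p 3 κ (WildCones.step p 3 κ i τ c)) ∧
          ∀ (i : Fin 3) (τ : Fin 3 → κ), WildCones.MultP p 3 κ (WildCones.step p 3 κ i τ c) →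
            ¬ WildCones.Isol p 3 κ (WildCones.step p 3 κ i τ c))

end Summit.ResolutionOfSingularities.ResolutionOfSingularities.Theorems

end
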